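import Summits.QuantumFields.BalabanUV.T4Continuum.Support.SkeletonFillUnitary

/-!
# T⁴ programme, node NE3 — the kinematic refinement lemma, leaf R1a+R1b (row NE3-S4c), file 3b:
# THE 2-SKELETON THEOREMS FOR ANY LAWFUL EXTENSION — the matrix-level statements of `SkeletonFillUnitary` (plaquettes =
# unitary roots, fluxes `= L^{−2}·log T(∂p)`, in-cell covariant gradients `0`, cross-line ones `= L^{−2} ×` the coarse
# ones) for EVERY configuration `W` with `LawfulFill L T (rootH L T) W`, e.g. the full filling `fullFill` of row S4d

Cell `pub-balaban`, NE3 (node U1b) formalisation swarm, unit `b2b-balaban-t4-ne3-formalise-leaf-01` (LEAF PROVER 01),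
row **S4c** of `t4/formal/NE3/LEAVES.md`.  File 3 (`SkeletonFillUnitary`) stated its §2 for the particular extension
`fill2 L T = skelFill L T (rootH L T)` (value `1` off the 2-skeleton).  Row S4d's complete filling
`SkeletonFillFull.fullFill L T (rootH L T)` (leaf-07, p211091) is a DIFFERENT function off the 2-skeleton but LAWFUL on it
(`LawfulFill`, file 2), and the R1 assembly (row R1-asm, leaf-09) consumes the 2-cell facts for THAT `W`.  Every proof of
file 3 §2 used only `LawfulFill` (through `val_horizontal` ∕ `val_vertical` ∕ `hol_plaq_eq` ∕ `hol_seg_eq` of file 2),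
so here the same statements are given for an arbitrary lawful `W` under the datum shape `SkeletonDatum L P a T`:
`hol_seg_lawful` ∕ `bavg_lawful` (chain products `= T`, (42) with the chain evaluated), `hol_plaq_lawful` ∕ `fhol_lawful`
(every fine plaquette of a coarse 2-cell IS `rootH L T z κ ν`), `norm_fhol_lawful_sub_one_le` (`≤ 4a/L²`), `flux_lawful`
(`= rootLog L T z κ ν = L^{−2} • mlog T(∂p)`), `covGrad_lawful_inCell_left∕right = 0`, `covGrad_lawful_cross_left∕right`
(`= Ad_{h^{−t}} ∕ Ad_{h^{sL}} (L^{−2} • covGrad T (flux T) z μ π)`, exact) and their norm forms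
(`= L^{−2} · ‖covGrad T (flux T) z μ π‖`).  Unitarity ∕ periodicity of a general lawful `W` depend on its off-skeleton
values and are NOT asserted here (for `fullFill` they are row S4d's theorems).

HONEST FRAMING.  Elementary lattice gauge kinematics; no estimate of the series, no minimiser; no conditional of the cell
(`BetaPertH`, (B), (B^μ)) is used or hidden; nothing bears on infinite volume, a mass gap, or the Clay problem; **NE3 is
NOT proved**, `SmoothRefine` ∕ `ApproxRefine` are NOT proved here.  Finite T⁴ rung (B)+1.  ABSOLUTE RULE kept: no printed
sentence is a hypothesis of any declaration; no `sorry`, axioms ⊆ {propext, Classical.choice, Quot.sound}.  PLACEMENT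
(human rule 2026-08-19): cell work under `Summits/QuantumFields/BalabanUV/`; imports file 3 only; moves nothing.
-/

set_option autoImplicit false

open scoped BigOperators Matrix Matrix.Norms.L2Operator
open NormedSpace Finset

namespace Summit.QuantumFields.BalabanUV.T4Continuum.SkeletonFillLawful

open Literature.MathematicalPhysics.QuantumFieldTheory.Balaban1983to89
open B7Prop1Explicit B7Prop2Explicit B7Prop1Local MatrixLog
open T4AveragingDeficitWall hiding Site Plane Plaq Bond
open T4AveragingDeficitWallBoundary (IsPeriodicCfg)
open AveragingDeficitTransport (norm_Ad_of_unitary)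
open AveragingDeficitNearIdentity (Ad_one Ad_real_smul)
open T4AveragingDeficitNonAbelian (Ad_mul Ad_sub)
open SkeletonLattice SkeletonFill SkeletonFillUnitary

noncomputable section

variable {d : ℕ} {n : Type*} [Fintype n] [DecidableEq n]
variable {L : ℕ} {P : ℤ} {a : ℝ} {T W : B7Prop1Explicit.Site d → Fin d → (Matrix n n ℂ)ˣ}

/-- **CHAIN PRODUCTS** of a lawful configuration: `W(Γ_c) = T(c)`. [folklore] -/
theorem hol_seg_lawful (hW : LawfulFill L T (rootH L T) W) (hL : 1 ≤ L) (z : B7Prop1Explicit.Site d) (κ : Fin d) :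
    hol W ((L : ℤ) • z) (seg κ L) = T z κ :=
  hol_seg_eq hW hL z κ

/-- (42) for a lawful configuration with the chain product evaluated: `\overline W(c) = exp(X_c(W)) · T(c)`. [folklore] -/
theorem bavg_lawful (hW : LawfulFill L T (rootH L T) W) (hL : 1 ≤ L) (z : B7Prop1Explicit.Site d) (κ : Fin d) :
    bavg L W ((L : ℤ) • z) κ = expUnit (Xavg L W ((L : ℤ) • z) κ) * T z κ := by
  rw [bavg, hol_seg_lawful hW hL]

/-- **EVERY FINE PLAQUETTE OF A COARSE 2-CELL OF A LAWFUL CONFIGURATION IS THE UNITARY ROOT** `rootH L T z κ ν`.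
[folklore] -/
theorem hol_plaq_lawful (hW : LawfulFill L T (rootH L T) W) (hD : SkeletonDatum L P a T) {κ ν : Fin d}
    (hκν : κ < ν) (z : B7Prop1Explicit.Site d) {s t : ℕ} (hs : s < L) (ht : t < L) :
    hol W ((L : ℤ) • z + off2 κ ν s t) (plaqWord κ ν) = rootH L T z κ ν :=
  hol_plaq_eq hW hκν z (rootH_pow hD.one_le T z κ ν (by linarith [hD.small_all z κ ν])) hs ht

/-- The same in `fhol` notation. [folklore] -/
theorem fhol_lawful (hW : LawfulFill L T (rootH L T) W) (hD : SkeletonDatum L P a T) {κ ν : Fin d} (hκν : κ < ν)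
    (z : B7Prop1Explicit.Site d) {s t : ℕ} (hs : s < L) (ht : t < L) :
    fhol W ((L : ℤ) • z + off2 κ ν s t, ⟨(κ, ν), hκν⟩) = rootH L T z κ ν :=
  hol_plaq_lawful hW hD hκν z hs ht

/-- **SMALL FIELD ON THE 2-SKELETON** for a lawful configuration: `‖W(∂p) − 1‖ ≤ 4a/L²` on every 2-cell plaquette.
[folklore] -/
theorem norm_fhol_lawful_sub_one_le (hW : LawfulFill L T (rootH L T) W) (hD : SkeletonDatum L P a T) {κ ν : Fin d}
    (hκν : κ < ν) (z : B7Prop1Explicit.Site d) {s t : ℕ} (hs : s < L) (ht : t < L) :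
    ‖((fhol W ((L : ℤ) • z + off2 κ ν s t, ⟨(κ, ν), hκν⟩) : (Matrix n n ℂ)ˣ) : Matrix n n ℂ) - 1‖
      ≤ rootCoeff L * (4 * a) := by
  rw [fhol_lawful hW hD hκν z hs ht]
  exact norm_rootH_sub_one_le hD.one_le T z κ ν (hD.small z κ ν (ne_of_lt hκν)) hD.le_quarter

/-- **THE FLUX OF A 2-CELL PLAQUETTE OF A LAWFUL CONFIGURATION IS `L^{−2} · log T(∂p)`**. [folklore] -/
theorem flux_lawful (hW : LawfulFill L T (rootH L T) W) (hD : SkeletonDatum L P a T) {κ ν : Fin d} (hκν : κ < ν)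
    (z : B7Prop1Explicit.Site d) {s t : ℕ} (hs : s < L) (ht : t < L) :
    flux W ((L : ℤ) • z + off2 κ ν s t, ⟨(κ, ν), hκν⟩) = rootLog L T z κ ν := by
  rw [flux, fhol_lawful hW hD hκν z hs ht, rootH, val_expUnit]
  refine B7BlockAvgLog.mlog_exp ?_
  have ha0 := hD.nonneg (ne_of_lt hκν)
  have hY := norm_rootLog_le (L := L) T z κ ν (hD.small z κ ν (ne_of_lt hκν)) (by linarith [hD.le_quarter])
  have hc := rootCoeff_le_one hD.one_le
  have : rootCoeff L * (2 * a) ≤ 1 / 2 := by nlinarith [hD.le_quarter, rootCoeff_nonneg L]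
  linarith [Real.log_two_gt_d9]

/-- In-cell covariant flux gradients of a lawful configuration vanish, direction `κ` (`s + 1 < L`). [folklore] -/
theorem covGrad_lawful_inCell_left (hW : LawfulFill L T (rootH L T) W) (hD : SkeletonDatum L P a T) {κ ν : Fin d}
    (hκν : κ < ν) (z : B7Prop1Explicit.Site d) {s t : ℕ} (hs : s + 1 < L) (ht : t < L) :
    covGrad W (flux W) ((L : ℤ) • z + off2 κ ν s t) κ ⟨(κ, ν), hκν⟩ = 0 := by
  rw [covGrad, add_assoc, off2_add_e_left, flux_lawful hW hD hκν z hs ht, flux_lawful hW hD hκν z (by omega) ht,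
    val_horizontal hW hκν z (by omega) ht, if_neg (by omega), mul_one, (Ad_rootH_pow_rootLog L T z κ ν t).2, sub_self]

/-- In-cell covariant flux gradients of a lawful configuration vanish, direction `ν` (`t + 1 < L`). [folklore] -/
theorem covGrad_lawful_inCell_right (hW : LawfulFill L T (rootH L T) W) (hD : SkeletonDatum L P a T) {κ ν : Fin d}
    (hκν : κ < ν) (z : B7Prop1Explicit.Site d) {s t : ℕ} (hs : s < L) (ht : t + 1 < L) :
    covGrad W (flux W) ((L : ℤ) • z + off2 κ ν s t) ν ⟨(κ, ν), hκν⟩ = 0 := by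
  rw [covGrad, add_assoc, off2_add_e_right, flux_lawful hW hD hκν z hs ht, flux_lawful hW hD hκν z hs (by omega),
    val_vertical hW hκν z hs (by omega), if_neg (by omega), Ad_one, sub_self]

/-- Cross-line covariant flux gradient of a lawful configuration, direction `κ` (exact). [folklore] -/
theorem covGrad_lawful_cross_left (hW : LawfulFill L T (rootH L T) W) (hD : SkeletonDatum L P a T) {κ ν : Fin d}
    (hκν : κ < ν) (z : B7Prop1Explicit.Site d) {t : ℕ} (ht : t < L) :
    covGrad W (flux W) ((L : ℤ) • z + off2 κ ν (L - 1) t) κ ⟨(κ, ν), hκν⟩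
      = Ad ((rootH L T z κ ν ^ t)⁻¹) (rootCoeff L • covGrad T (flux T) z κ ⟨(κ, ν), hκν⟩) := by
  have hL := hD.one_le
  have hc := carry_left hL κ ν z t
  rw [Nat.sub_add_cancel hL] at hc
  rw [covGrad, add_assoc, off2_add_e_left, Nat.sub_add_cancel hL, hc, flux_lawful hW hD hκν (z + e κ) (by omega) ht,
    flux_lawful hW hD hκν z (by omega) ht,
    val_horizontal hW hκν z (by omega) ht, if_pos rfl, Ad_mul, covGrad_flux_datum, smul_sub,
    Ad_sub, ← rootLog, ← Ad_real_smul, ← rootLog, (Ad_rootH_pow_rootLog L T z κ ν t).2]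

/-- Cross-line covariant flux gradient of a lawful configuration, direction `ν` (exact). [folklore] -/
theorem covGrad_lawful_cross_right (hW : LawfulFill L T (rootH L T) W) (hD : SkeletonDatum L P a T) {κ ν : Fin d}
    (hκν : κ < ν) (z : B7Prop1Explicit.Site d) {s : ℕ} (hs : s < L) :
    covGrad W (flux W) ((L : ℤ) • z + off2 κ ν s (L - 1)) ν ⟨(κ, ν), hκν⟩
      = Ad (rootH L T z κ ν ^ (s * L)) (rootCoeff L • covGrad T (flux T) z ν ⟨(κ, ν), hκν⟩) := by
  have hL := hD.one_le
  have hc := carry_right hL κ ν z s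
  rw [Nat.sub_add_cancel hL] at hc
  rw [covGrad, add_assoc, off2_add_e_right, Nat.sub_add_cancel hL, hc, flux_lawful hW hD hκν (z + e ν) hs (by omega),
    flux_lawful hW hD hκν z hs (by omega),
    val_vertical hW hκν z hs (by omega), if_pos rfl, Ad_mul, covGrad_flux_datum, smul_sub,
    Ad_sub, ← rootLog, ← Ad_real_smul, ← rootLog, (Ad_rootH_pow_rootLog L T z κ ν (s * L)).1]

/-- Norm of the cross-line gradient, direction `κ`: `= L^{−2} · ‖(∇_T log T(∂p))(z, κ)‖`. [folklore] -/
theorem norm_covGrad_lawful_cross_left (hW : LawfulFill L T (rootH L T) W) (hD : SkeletonDatum L P a T)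
    {κ ν : Fin d} (hκν : κ < ν) (z : B7Prop1Explicit.Site d) {t : ℕ} (ht : t < L) :
    ‖covGrad W (flux W) ((L : ℤ) • z + off2 κ ν (L - 1) t) κ ⟨(κ, ν), hκν⟩‖
      = rootCoeff L * ‖covGrad T (flux T) z κ ⟨(κ, ν), hκν⟩‖ := by
  rw [covGrad_lawful_cross_left hW hD hκν z ht, norm_Ad_of_unitary, norm_smul, Real.norm_of_nonneg (rootCoeff_nonneg L)]
  exact (unitaryUnits _).inv_mem ((unitaryUnits _).pow_mem
    (rootH_mem_unitary hD.unitary z κ ν (hD.small_all z κ ν)) _)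

/-- Norm of the cross-line gradient, direction `ν`: `= L^{−2} · ‖(∇_T log T(∂p))(z, ν)‖`. [folklore] -/
theorem norm_covGrad_lawful_cross_right (hW : LawfulFill L T (rootH L T) W) (hD : SkeletonDatum L P a T)
    {κ ν : Fin d} (hκν : κ < ν) (z : B7Prop1Explicit.Site d) {s : ℕ} (hs : s < L) :
    ‖covGrad W (flux W) ((L : ℤ) • z + off2 κ ν s (L - 1)) ν ⟨(κ, ν), hκν⟩‖
      = rootCoeff L * ‖covGrad T (flux T) z ν ⟨(κ, ν), hκν⟩‖ := by
  rw [covGrad_lawful_cross_right hW hD hκν z hs, norm_Ad_of_unitary, norm_smul, Real.norm_of_nonneg (rootCoeff_nonneg L)]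
  exact (unitaryUnits _).pow_mem (rootH_mem_unitary hD.unitary z κ ν (hD.small_all z κ ν)) _

/-- The 2-skeleton BOND values of a lawful configuration are unitary under the datum hypotheses (the `cellVal` closed
form is a product of powers of unitary roots and unitary `T`'s); off the 2-skeleton nothing is asserted. [folklore] -/
theorem lawful_mem_unitary_of_tset (hW : LawfulFill L T (rootH L T) W) (hD : SkeletonDatum L P a T)
    (x : B7Prop1Explicit.Site d) (μ ν : Fin d) (h0 : ∀ i, i ≠ μ → i ≠ ν → cmod L x i = 0) :
    W x μ ∈ unitaryUnits (Matrix n n ℂ) := by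
  rw [hW x μ ν h0]
  exact cellVal_mem hD.unitary (fun z κ ν => rootH_mem_unitary hD.unitary z κ ν (hD.small_all z κ ν)) _ _ _ _

end

end Summit.QuantumFields.BalabanUV.T4Continuum.SkeletonFillLawful
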